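import Literature.Probability.Percolation.QuadCrossingRotationInvarianceOfThm21
import Literature.Probability.Percolation.QuadCrossingContinuityUniform
import Literature.Probability.Percolation.QuadCrossingContinuityEventsDischarge
import Literature.Probability.Percolation.QuadCrossingNullFrontier
import HarnessLib

/-!
# Stub `stub_perturbationContinuity` of crux `ClusterSetConnected` (stmt-CriticalPhenomena-5769)

The percolation input (S1c) of the line `registered`: for a plane homeomorphism `Φ` (the model
square `(-1, 1)²` read through `Φ`; arcs `0`/`2` = bottom/top sides, crossings vertical) and
`ε > 0` there are `s, θ, δ₁ > 0` such that for all meshes `0 < δ ≤ δ' < δ₁`, `δ' ≤ (1 + θ) δ`, the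
critical bond-`ℤ²` crossing probability of the wide-short perturbation
`W_s = perturbQuad Φ (-1-s) (1+s) (-1+s) (1-s)` at one mesh exceeds that of the tall-narrow one
`T_s = perturbQuad Φ (-1+s) (1-s) (-1-s) (1+s)` at the other mesh by less than `ε`.

Proof (Schramm–Smirnov 2011, eq. (5.1), PROVED in the tree for bond-`ℤ²`): (1)
`Quad.continuity_uniform_pair` with `Quad.continuity_of_lemma_5_1 SchrammSmirnov2011_lemma_5_1_holds`
on the compact family `{Q}`, `Q = squareModelQuad Φ`, at level `ε/2`, gives `δ₁, r > 0` with
`P[P' raw-crossed ∧ P'' not] ≤ ε/2` at meshes `< δ₁` for all quads `P', P''` within `r` of `Q`;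
(2) `T_s`, `W_s` are square-modelled by `A ≫ Φ`, `A = Quad.scaleXY a b : x + iy ↦ ax + iby`
(`isSquareModel_perturbQuad`), so their continuum crossing events are the raw events of
`squareModelQuad (A ≫ Φ)` (`quadCrossing_eq_setOf_exists_isCrossing`); (3) these quads are within
`r/4` of `Q` for small `s` (uniform continuity of `Φ` on `[-2, 2]²`); (4) dilations `κ • Q_T`,
`|κ - 1| ≤ θ = r/(4M)`, stay within `r/4` of `Q_T`; (5) the raw events are exactly dilation
covariant (`openEdgeUnion_mul`): `Q_T` raw-crossed at mesh `δ'` iff `(δ/δ') • Q_T` raw-crossed at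
mesh `δ`; (6) `P.real A - P.real B ≤ P.real (A ∖ B) ≤ ε/2 < ε`.
-/

noncomputable section

open Set Filter MeasureTheory Metric
open scoped unitInterval ENNReal
open Literature.Probability.Percolation Literature.Probability.LatticeModels
open Literature.Probability.RandomPlanarGeometry Literature.Probability.Percolation.QuadCrossing

namespace Summit.CriticalPhenomena.CardyFormulaZ2.Theorems.ClusterSetConnected

/-! ### Elementary real-arithmetic facts -/

/-- `t / c ∈ [-1, 1] ↔ t ∈ [-c, c]` for `c > 0`. -/
theorem div_mem_Icc_iff {c t : ℝ} (hc : 0 < c) : t / c ∈ Icc (-1 : ℝ) 1 ↔ t ∈ Icc (-c) c := by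
  rw [mem_Icc, mem_Icc, le_div_iff₀ hc, div_le_iff₀ hc, neg_one_mul, one_mul]

/-- `t / c ∈ (-1, 1) ↔ t ∈ (-c, c)` for `c > 0`. -/
theorem div_mem_Ioo_iff {c t : ℝ} (hc : 0 < c) : t / c ∈ Ioo (-1 : ℝ) 1 ↔ t ∈ Ioo (-c) c := by
  rw [mem_Ioo, mem_Ioo, lt_div_iff₀ hc, div_lt_iff₀ hc, neg_one_mul, one_mul]

/-- `t / c = -1 ↔ t = -c` for `c > 0`. -/
theorem div_eq_neg_one_iff {c t : ℝ} (hc : 0 < c) : t / c = -1 ↔ t = -c := by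
  rw [div_eq_iff hc.ne', neg_one_mul]

/-- `t / c = 1 ↔ t = c` for `c > 0`. -/
theorem div_eq_one_iff_of_pos {c t : ℝ} (hc : 0 < c) : t / c = 1 ↔ t = c := by
  rw [div_eq_iff hc.ne', one_mul]

/-- `|a t| ≤ 2` when `|a - 1| ≤ 1/2` and `|t| ≤ 1`. -/
theorem abs_mul_le_two {a t : ℝ} (ha : |a - 1| ≤ 1 / 2) (ht : |t| ≤ 1) : |a * t| ≤ 2 := by
  rw [abs_mul]
  have ha' : |a| ≤ 3 / 2 := by
    have := abs_le.1 ha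
    exact abs_le.2 ⟨by linarith [this.1], by linarith [this.2]⟩
  calc |a| * |t| ≤ 3 / 2 * 1 := mul_le_mul ha' ht (abs_nonneg _) (by norm_num)
    _ ≤ 2 := by norm_num

/-! ### The coordinate scalings `A_{a,b} : x + iy ↦ a x + i b y` -/

/-- Real and imaginary parts of `A_{a,b} w = a x + i b y` (`w = x + iy`). -/
theorem scaleXY_re_im (a b : ℝ) (ha : a ≠ 0) (hb : b ≠ 0) (w : ℂ) :
    (Quad.scaleXY a b ha hb w).re = a * w.re ∧ (Quad.scaleXY a b ha hb w).im = b * w.im :=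
  Quad.re_im_ofReal_add_ofReal_mul_I _ _

/-- Real and imaginary parts of `A_{a,b}⁻¹ w = x/a + i y/b` (`w = x + iy`). -/
theorem scaleXY_symm_re_im (a b : ℝ) (ha : a ≠ 0) (hb : b ≠ 0) (w : ℂ) :
    ((Quad.scaleXY a b ha hb).symm w).re = w.re / a ∧
      ((Quad.scaleXY a b ha hb).symm w).im = w.im / b :=
  Quad.re_im_ofReal_add_ofReal_mul_I _ _

/-- Points of the chart of the model square lie in `[-1, 1]²`. -/
theorem unitSquareChart_mem (z : I × I) : unitSquareChart z ∈ Icc (-1 : ℝ) 1 ×ℂ Icc (-1 : ℝ) 1 := by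
  rw [← range_unitSquareChart]
  exact mem_range_self z

/-- `A_{a,b}` maps `[-1, 1]²` into `[-2, 2]²` when `|a - 1|, |b - 1| ≤ 1/2`. -/
theorem scaleXY_mem_rect_two {a b : ℝ} (ha0 : a ≠ 0) (hb0 : b ≠ 0) (ha : |a - 1| ≤ 1 / 2)
    (hb : |b - 1| ≤ 1 / 2) {w : ℂ} (hw : w ∈ Icc (-1 : ℝ) 1 ×ℂ Icc (-1 : ℝ) 1) :
    Quad.scaleXY a b ha0 hb0 w ∈ Icc (-2 : ℝ) 2 ×ℂ Icc (-2 : ℝ) 2 := by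
  rw [Complex.mem_reProdIm, mem_Icc, mem_Icc] at hw
  rw [Complex.mem_reProdIm, (scaleXY_re_im a b ha0 hb0 w).1, (scaleXY_re_im a b ha0 hb0 w).2,
    mem_Icc, mem_Icc]
  exact ⟨abs_le.1 (abs_mul_le_two ha (abs_le.2 hw.1)), abs_le.1 (abs_mul_le_two hb (abs_le.2 hw.2))⟩

/-- `‖A_{a,b} w - w‖ ≤ |a - 1| + |b - 1|` on `[-1, 1]²`. -/
theorem norm_scaleXY_sub_le {a b : ℝ} (ha0 : a ≠ 0) (hb0 : b ≠ 0) {w : ℂ}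
    (hw : w ∈ Icc (-1 : ℝ) 1 ×ℂ Icc (-1 : ℝ) 1) :
    ‖Quad.scaleXY a b ha0 hb0 w - w‖ ≤ |a - 1| + |b - 1| := by
  rw [Complex.mem_reProdIm, mem_Icc, mem_Icc] at hw
  have e : Quad.scaleXY a b ha0 hb0 w - w =
      ((((a - 1) * w.re : ℝ)) : ℂ) + ((((b - 1) * w.im : ℝ)) : ℂ) * Complex.I := by
    apply Complex.ext
    · rw [Complex.sub_re, (scaleXY_re_im a b ha0 hb0 w).1,
        (Quad.re_im_ofReal_add_ofReal_mul_I _ _).1]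
      ring
    · rw [Complex.sub_im, (scaleXY_re_im a b ha0 hb0 w).2,
        (Quad.re_im_ofReal_add_ofReal_mul_I _ _).2]
      ring
  rw [e]
  refine (Complex.norm_le_abs_re_add_abs_im _).trans ?_
  rw [(Quad.re_im_ofReal_add_ofReal_mul_I _ _).1, (Quad.re_im_ofReal_add_ofReal_mul_I _ _).2,
    abs_mul, abs_mul]
  have hre : |w.re| ≤ 1 := abs_le.2 hw.1
  have him : |w.im| ≤ 1 := abs_le.2 hw.2
  have e1 : |a - 1| * |w.re| ≤ |a - 1| * 1 := mul_le_mul_of_nonneg_left hre (abs_nonneg _)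
  have e2 : |b - 1| * |w.im| ≤ |b - 1| * 1 := mul_le_mul_of_nonneg_left him (abs_nonneg _)
  linarith

/-! ### The perturbed quads are modelled by `A_{a,b} ≫ Φ` -/

/-- `A_{a,b}` is a square model of the rectangle `(-a, a) × (-b, b)`: it maps the model square onto
the rectangle and side `k` onto side `k`. -/
theorem isSquareModel_rectQuad_scaleXY {a b : ℝ} (ha : 0 < a) (hb : 0 < b) {x₀ x₁ y₀ y₁ : ℝ}
    (hx : x₀ < x₁) (hy : y₀ < y₁) (hx₀ : x₀ = -a) (hx₁ : x₁ = a) (hy₀ : y₀ = -b) (hy₁ : y₁ = b) :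
    IsSquareModel (rectQuad x₀ x₁ y₀ y₁ hx hy) (Quad.scaleXY a b ha.ne' hb.ne') := by
  subst hx₀ hx₁ hy₀ hy₁
  refine ⟨?_, fun k => ?_⟩
  · ext w
    rw [Homeomorph.image_eq_preimage_symm, mem_preimage, unitSquareQuad_carrier, rectQuad_carrier,
      Complex.mem_reProdIm, Complex.mem_reProdIm, (scaleXY_symm_re_im _ _ _ _ w).1,
      (scaleXY_symm_re_im _ _ _ _ w).2, div_mem_Ioo_iff ha, div_mem_Ioo_iff hb]
  · match k with
    | 0 =>
      ext w
      rw [Homeomorph.image_eq_preimage_symm, mem_preimage, SquareModel.mem_arc_zero,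
        mem_rectQuad_arc_zero hx hy, (scaleXY_symm_re_im _ _ _ _ w).1,
        (scaleXY_symm_re_im _ _ _ _ w).2, div_eq_neg_one_iff hb, div_mem_Icc_iff ha]
    | 1 =>
      ext w
      rw [Homeomorph.image_eq_preimage_symm, mem_preimage, SquareModel.mem_arc_one,
        mem_rectQuad_arc_one hx hy, (scaleXY_symm_re_im _ _ _ _ w).1,
        (scaleXY_symm_re_im _ _ _ _ w).2, div_eq_one_iff_of_pos ha, div_mem_Icc_iff hb]
    | 2 =>
      ext w
      rw [Homeomorph.image_eq_preimage_symm, mem_preimage, SquareModel.mem_arc_two,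
        mem_rectQuad_arc_two hx hy, (scaleXY_symm_re_im _ _ _ _ w).1,
        (scaleXY_symm_re_im _ _ _ _ w).2, div_eq_one_iff_of_pos hb, div_mem_Icc_iff ha]
    | 3 =>
      ext w
      rw [Homeomorph.image_eq_preimage_symm, mem_preimage, SquareModel.mem_arc_three,
        mem_rectQuad_arc_three hx hy, (scaleXY_symm_re_im _ _ _ _ w).1,
        (scaleXY_symm_re_im _ _ _ _ w).2, div_eq_neg_one_iff ha, div_mem_Icc_iff hb]

/-- Square models compose with plane homeomorphisms: if `Ψ` models `R` then `Ψ ≫ Φ` models `Φ(R)`. -/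
theorem isSquareModel_map_trans {R : ConformalRectangle} {Ψ : ℂ ≃ₜ ℂ} (h : IsSquareModel R Ψ)
    (Φ : ℂ ≃ₜ ℂ) : IsSquareModel (R.map Φ) (Ψ.trans Φ) := by
  refine ⟨?_, fun k => ?_⟩
  · rw [MarkedDomain.carrier_map, ← h.image_carrier, Set.image_image]
    rfl
  · rw [MarkedDomain.arc_map, ← h.image_arc k, Set.image_image]
    rfl

/-- **The perturbed quad `Φ([-a, a] × [-b, b])` is modelled by `A_{a,b} ≫ Φ`.** -/
theorem isSquareModel_perturbQuad (Φ : ℂ ≃ₜ ℂ) {a b : ℝ} (ha : 0 < a) (hb : 0 < b)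
    {x₀ x₁ y₀ y₁ : ℝ} (hx : x₀ < x₁) (hy : y₀ < y₁) (hx₀ : x₀ = -a) (hx₁ : x₁ = a) (hy₀ : y₀ = -b)
    (hy₁ : y₁ = b) :
    IsSquareModel (perturbQuad Φ x₀ x₁ y₀ y₁ hx hy) ((Quad.scaleXY a b ha.ne' hb.ne').trans Φ) :=
  isSquareModel_map_trans (isSquareModel_rectQuad_scaleXY ha hb hx hy hx₀ hx₁ hy₀ hy₁) Φ

/-- **Bridge**: the continuum crossing event of the perturbed quad `Φ([-a, a] × [-b, b])` at a
positive mesh is the raw Schramm–Smirnov event of its modelling quad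
`squareModelQuad (A_{a,b} ≫ Φ) ∈ 𝒬_ℂ`. -/
theorem quadCrossing_perturbQuad_eq_raw (Φ : ℂ ≃ₜ ℂ) {a b : ℝ} (ha : 0 < a) (hb : 0 < b)
    {x₀ x₁ y₀ y₁ : ℝ} (hx : x₀ < x₁) (hy : y₀ < y₁) (hx₀ : x₀ = -a) (hx₁ : x₁ = a) (hy₀ : y₀ = -b)
    (hy₁ : y₁ = b) {η : ℝ} (hη : 0 < η) :
    quadCrossing (perturbQuad Φ x₀ x₁ y₀ y₁ hx hy) η =
      {ω | ∃ K, (squareModelQuad ((Quad.scaleXY a b ha.ne' hb.ne').trans Φ)).IsCrossing K ∧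
        K ⊆ openEdgeUnion η ω} :=
  have h := isSquareModel_perturbQuad Φ ha hb hx hy hx₀ hx₁ hy₀ hy₁
  quadCrossing_eq_setOf_exists_isCrossing h.carrier_squareModelQuad h.side_zero_squareModelQuad
    h.side_two_squareModelQuad hη

/-! ### Dilation covariance of the raw crossing events -/

/-- **Exact dilation covariance**: `Q` is raw-crossed inside the open edges of `ηℤ²` iff
`κ • Q` is raw-crossed inside the open edges of `(κη)ℤ²` (`openEdgeUnion (κη) ω = κ • openEdgeUnion η ω`
and plane homeomorphisms carry crossings to crossings). -/
theorem setOf_raw_mapHomeomorph_mulLeft₀ {κ : ℝ} (hκ : κ ≠ 0) (P : Quad (univ : Set ℂ)) (η : ℝ) :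
    {ω : BondConfig (Site 2) | ∃ K,
        (P.mapHomeomorph (Homeomorph.mulLeft₀ (κ : ℂ) (Complex.ofReal_ne_zero.2 hκ))).IsCrossing K ∧
          K ⊆ openEdgeUnion (κ * η) ω} =
      {ω | ∃ K, P.IsCrossing K ∧ K ⊆ openEdgeUnion η ω} := by
  ext ω
  have hg : openEdgeUnion (κ * η) ω =
      Homeomorph.mulLeft₀ (κ : ℂ) (Complex.ofReal_ne_zero.2 hκ) '' openEdgeUnion η ω := by
    rw [openEdgeUnion_mul, Homeomorph.coe_mulLeft₀]
  simp only [mem_setOf_eq]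
  constructor
  · rintro ⟨K, hK, hKω⟩
    refine ⟨(Homeomorph.mulLeft₀ (κ : ℂ) (Complex.ofReal_ne_zero.2 hκ)).symm '' K,
      (Quad.isCrossing_mapHomeomorph_iff _).1 hK, ?_⟩
    rw [hg] at hKω
    rintro _ ⟨w, hw, rfl⟩
    obtain ⟨u, hu, rfl⟩ := hKω hw
    simpa only [Homeomorph.symm_apply_apply] using hu
  · rintro ⟨K, hK, hKω⟩
    refine ⟨Homeomorph.mulLeft₀ (κ : ℂ) (Complex.ofReal_ne_zero.2 hκ) '' K, hK.image _, ?_⟩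
    rw [hg]
    exact image_mono hKω

/-! ### Distance estimates in `𝒬_ℂ` -/

/-- **The modelling quads of the perturbations are close to the quad of `Φ`**: if `Φ` is
`(η, c)`-uniformly continuous on `[-2, 2]²` and `|a - 1|, |b - 1| ≤ s ≤ 1/2`, `2s < η`, then
`dist (squareModelQuad (A_{a,b} ≫ Φ)) (squareModelQuad Φ) < c`. -/
theorem dist_squareModelQuad_scaleXY_lt (Φ : ℂ ≃ₜ ℂ) {η c s a b : ℝ}
    (hU : ∀ w ∈ Icc (-2 : ℝ) 2 ×ℂ Icc (-2 : ℝ) 2, ∀ w' ∈ Icc (-2 : ℝ) 2 ×ℂ Icc (-2 : ℝ) 2,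
      dist w w' < η → dist (Φ w) (Φ w') < c)
    (hs : s ≤ 1 / 2) (hsη : 2 * s < η) (ha : |a - 1| ≤ s) (hb : |b - 1| ≤ s) (ha0 : a ≠ 0)
    (hb0 : b ≠ 0) :
    dist (squareModelQuad ((Quad.scaleXY a b ha0 hb0).trans Φ)) (squareModelQuad Φ) < c := by
  refine Quad.dist_lt_of_forall fun z => ?_
  rw [squareModelQuad_apply, squareModelQuad_apply, Homeomorph.trans_apply]
  have hw := unitSquareChart_mem z
  refine hU _ (scaleXY_mem_rect_two ha0 hb0 (ha.trans hs) (hb.trans hs) hw) _ ?_ ?_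
  · rw [Complex.mem_reProdIm, mem_Icc, mem_Icc] at hw ⊢
    obtain ⟨⟨h1, h2⟩, h3, h4⟩ := hw
    exact ⟨⟨by linarith, by linarith⟩, by linarith, by linarith⟩
  · rw [dist_eq_norm]
    refine (norm_scaleXY_sub_le ha0 hb0 hw).trans_lt ?_
    linarith

/-- **Dilations close to the identity move a quad little**: if `‖P z‖ ≤ M` for all `z` and
`|κ - 1| ≤ θ` then `dist (κ • P) P ≤ θ M`. -/
theorem dist_mapHomeomorph_mulLeft₀_le (P : Quad (univ : Set ℂ)) {M θ κ : ℝ} (hκ : (κ : ℂ) ≠ 0)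
    (hM : ∀ z, ‖P z‖ ≤ M) (hM0 : 0 ≤ M) (hθ : |κ - 1| ≤ θ) :
    dist (P.mapHomeomorph (Homeomorph.mulLeft₀ (κ : ℂ) hκ)) P ≤ θ * M := by
  have hθ0 : 0 ≤ θ := (abs_nonneg _).trans hθ
  refine Quad.dist_le_of_forall (mul_nonneg hθ0 hM0) fun z => ?_
  simp only [Quad.mapHomeomorph_apply, Homeomorph.coe_mulLeft₀]
  rw [dist_eq_norm]
  have e : (κ : ℂ) * P z - P z = ((κ - 1 : ℝ) : ℂ) * P z := by push_cast; ring
  rw [e, norm_mul, Complex.norm_real, Real.norm_eq_abs]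
  exact mul_le_mul hθ (hM z) (norm_nonneg _) hθ0

/-! ### Measure bookkeeping -/

/-- If `μ {A ∧ ¬ B} ≤ ε/2` (in `ℝ≥0∞`, `μ` finite) then `μ.real A - μ.real B < ε`
(`μ A ≤ μ (A ∖ B) + μ B`). -/
theorem measureReal_sub_lt_of_le_ofReal_half {Ω : Type*} [MeasurableSpace Ω] (μ : Measure Ω)
    [IsFiniteMeasure μ] {A B : Set Ω} {ε : ℝ} (hε : 0 < ε)
    (h : μ {ω | ω ∈ A ∧ ω ∉ B} ≤ ENNReal.ofReal (ε / 2)) : μ.real A - μ.real B < ε := by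
  have h1 : μ.real A ≤ μ.real (A \ B ∪ B) :=
    measureReal_mono fun x hx => (em (x ∈ B)).elim (fun h => Or.inr h) fun h => Or.inl ⟨hx, h⟩
  have h2 : μ.real (A \ B ∪ B) ≤ μ.real (A \ B) + μ.real B := measureReal_union_le _ _
  have h3 : μ.real (A \ B) ≤ ε / 2 := by
    rw [measureReal_def]
    exact ENNReal.toReal_le_of_le_ofReal (half_pos hε).le h
  linarith

/-! ### The stub -/

/-- **stub_perturbationContinuity** (S1c, the percolation input: Schramm–Smirnov's discrete
continuity estimate (5.1), proved in the tree, combined with exact dilation covariance of the raw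
crossing events): for every plane homeomorphism `Φ` and `ε > 0` there are a perturbation size
`s > 0`, a ratio margin `θ > 0` and a mesh bound `δ₁ > 0` such that for all meshes
`0 < δ ≤ δ' < δ₁` with `δ' ≤ (1 + θ) δ` the crossing probability of the wide-short perturbation
`W_s` at one mesh exceeds that of the tall-narrow perturbation `T_s` at the other mesh by less
than `ε`, in both orders. -/
theorem stub_perturbationContinuity :
    ∀ (Φ : ℂ ≃ₜ ℂ) (ε : ℝ), 0 < ε →
      ∃ (s : ℝ) (hxT : (-1 + s : ℝ) < 1 - s) (hyT : (-1 - s : ℝ) < 1 + s)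
        (hxW : (-1 - s : ℝ) < 1 + s) (hyW : (-1 + s : ℝ) < 1 - s), 0 < s ∧
        ∃ θ > (0 : ℝ), ∃ δ₁ > (0 : ℝ), ∀ δ δ' : ℝ, 0 < δ → δ ≤ δ' → δ' < δ₁ → δ' ≤ (1 + θ) * δ →
          (Literature.Probability.Percolation.bondPercolation
                (Literature.Probability.LatticeModels.zdGraph 2) Literature.Probability.Percolation.half).real
              (Literature.Probability.Percolation.quadCrossing
                (Literature.Probability.Percolation.perturbQuad Φ (-1 - s) (1 + s) (-1 + s) (1 - s) hxW hyW) δ) -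
            (Literature.Probability.Percolation.bondPercolation
                (Literature.Probability.LatticeModels.zdGraph 2) Literature.Probability.Percolation.half).real
              (Literature.Probability.Percolation.quadCrossing
                (Literature.Probability.Percolation.perturbQuad Φ (-1 + s) (1 - s) (-1 - s) (1 + s) hxT hyT) δ') < ε ∧
          (Literature.Probability.Percolation.bondPercolation
                (Literature.Probability.LatticeModels.zdGraph 2) Literature.Probability.Percolation.half).real
              (Literature.Probability.Percolation.quadCrossing
                (Literature.Probability.Percolation.perturbQuad Φ (-1 - s) (1 + s) (-1 + s) (1 - s) hxW hyW) δ') -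
            (Literature.Probability.Percolation.bondPercolation
                (Literature.Probability.LatticeModels.zdGraph 2) Literature.Probability.Percolation.half).real
              (Literature.Probability.Percolation.quadCrossing
                (Literature.Probability.Percolation.perturbQuad Φ (-1 + s) (1 - s) (-1 - s) (1 + s) hxT hyT) δ) < ε := by
  intro Φ ε hε
  -- (1) Schramm–Smirnov's (5.1), uniformly near the quad `Q` of `Φ`, at level `ε / 2`
  have hε2 : 0 < ε / 2 := half_pos hε
  obtain ⟨δ₁, hδ₁, r, hr, Hpair⟩ := Quad.continuity_uniform_pair (D := (univ : Set ℂ))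
    (μ := bondPercolation (zdGraph 2) half)
    (fun Q₀ e he => Quad.continuity_of_lemma_5_1 SchrammSmirnov2011_lemma_5_1_holds Q₀ e he)
    (isCompact_singleton (x := squareModelQuad Φ)) (ENNReal.ofReal (ε / 2))
    (ENNReal.ofReal_pos.2 hε2)
  -- (3) uniform continuity and boundedness of `Φ` on `[-2, 2]²`
  have hK₂ : IsCompact (Icc (-2 : ℝ) 2 ×ℂ Icc (-2 : ℝ) 2) := isCompact_Icc.reProdIm isCompact_Icc
  have hr4 : 0 < r / 4 := by positivity
  obtain ⟨η, hη, hU⟩ := Metric.uniformContinuousOn_iff.1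
    (hK₂.uniformContinuousOn_of_continuous Φ.continuous.continuousOn) (r / 4) hr4
  obtain ⟨M₀, hM₀⟩ := hK₂.exists_bound_of_continuousOn Φ.continuous.continuousOn
  obtain ⟨M, hM₀M, hM0⟩ : ∃ M : ℝ, M₀ ≤ M ∧ 0 < M :=
    ⟨max M₀ 1, le_max_left _ _, one_pos.trans_le (le_max_right _ _)⟩
  -- the perturbation size `s`
  obtain ⟨s, hs0, hs4, hsη⟩ : ∃ s : ℝ, 0 < s ∧ s ≤ 1 / 4 ∧ 2 * s < η :=
    ⟨min (η / 4) (1 / 4), lt_min (by positivity) (by norm_num), min_le_right _ _,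
      by linarith [min_le_left (η / 4) (1 / 4)]⟩
  -- the ratio margin `θ`
  obtain ⟨θ, hθ, hθM⟩ : ∃ θ : ℝ, 0 < θ ∧ θ * M = r / 4 :=
    ⟨r / 4 / M, by positivity, div_mul_cancel₀ (r / 4) hM0.ne'⟩
  have hxT : (-1 + s : ℝ) < 1 - s := by linarith
  have hyT : (-1 - s : ℝ) < 1 + s := by linarith
  have hxW : (-1 - s : ℝ) < 1 + s := by linarith
  have hyW : (-1 + s : ℝ) < 1 - s := by linarith
  refine ⟨s, hxT, hyT, hxW, hyW, hs0, θ, hθ, δ₁, hδ₁, fun δ δ' hδ hδδ' hδ'₁ hratio => ?_⟩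
  have hδ' : 0 < δ' := hδ.trans_le hδδ'
  have hδ₁' : δ < δ₁ := hδδ'.trans_lt hδ'₁
  -- (2) the modelling quads
  have h1s : (0 : ℝ) < 1 - s := by linarith
  have h1s' : (0 : ℝ) < 1 + s := by linarith
  set T := perturbQuad Φ (-1 + s) (1 - s) (-1 - s) (1 + s) hxT hyT
  set W := perturbQuad Φ (-1 - s) (1 + s) (-1 + s) (1 - s) hxW hyW
  set Q : Quad (univ : Set ℂ) := squareModelQuad Φ
  set QT : Quad (univ : Set ℂ) :=
    squareModelQuad ((Quad.scaleXY (1 - s) (1 + s) h1s.ne' h1s'.ne').trans Φ) with hQT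
  set QW : Quad (univ : Set ℂ) :=
    squareModelQuad ((Quad.scaleXY (1 + s) (1 - s) h1s'.ne' h1s.ne').trans Φ)
  have hTraw : ∀ {t : ℝ}, 0 < t →
      quadCrossing T t = {ω | ∃ K, QT.IsCrossing K ∧ K ⊆ openEdgeUnion t ω} := fun ht =>
    quadCrossing_perturbQuad_eq_raw Φ h1s h1s' hxT hyT (by ring) rfl (by ring) rfl ht
  have hWraw : ∀ {t : ℝ}, 0 < t →
      quadCrossing W t = {ω | ∃ K, QW.IsCrossing K ∧ K ⊆ openEdgeUnion t ω} := fun ht =>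
    quadCrossing_perturbQuad_eq_raw Φ h1s' h1s hxW hyW (by ring) rfl (by ring) rfl ht
  -- (3) closeness of `QT`, `QW` to `Q`
  have hTa : |1 - s - 1| ≤ s := by
    rw [show (1 : ℝ) - s - 1 = -s by ring, abs_neg, abs_of_pos hs0]
  have hTb : |1 + s - 1| ≤ s := by
    rw [show (1 : ℝ) + s - 1 = s by ring, abs_of_pos hs0]
  have hs2 : s ≤ 1 / 2 := by linarith
  have hdT : dist QT Q < r / 4 := dist_squareModelQuad_scaleXY_lt Φ hU hs2 hsη hTa hTb _ _
  have hdW : dist QW Q < r := (dist_squareModelQuad_scaleXY_lt Φ hU hs2 hsη hTb hTa _ _).trans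
    (by linarith)
  -- (4) a bound for `QT` and the dilated quads
  have hQTM : ∀ z, ‖QT z‖ ≤ M := fun z => by
    rw [hQT, squareModelQuad_apply, Homeomorph.trans_apply]
    exact (hM₀ _ (scaleXY_mem_rect_two _ _ (hTa.trans hs2) (hTb.trans hs2)
      (unitSquareChart_mem z))).trans hM₀M
  have hdil : ∀ {κ : ℝ} (hκC : (κ : ℂ) ≠ 0), |κ - 1| ≤ θ →
      dist (QT.mapHomeomorph (Homeomorph.mulLeft₀ (κ : ℂ) hκC)) Q < r := fun {κ} hκC hκ1 =>
    calc dist (QT.mapHomeomorph (Homeomorph.mulLeft₀ (κ : ℂ) hκC)) Q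
        ≤ dist (QT.mapHomeomorph (Homeomorph.mulLeft₀ (κ : ℂ) hκC)) QT + dist QT Q :=
          dist_triangle _ _ _
      _ ≤ θ * M + dist QT Q := by
          gcongr
          exact dist_mapHomeomorph_mulLeft₀_le QT hκC hQTM hM0.le hκ1
      _ < r := by rw [hθM]; linarith
  -- the two ratios `κ = δ/δ' ≤ 1 ≤ κ' = δ'/δ`, both within `θ` of `1`
  obtain ⟨κ, hκ0, hκδ, hκ1⟩ : ∃ κ : ℝ, 0 < κ ∧ κ * δ' = δ ∧ |κ - 1| ≤ θ := by
    refine ⟨δ / δ', div_pos hδ hδ', div_mul_cancel₀ δ hδ'.ne', abs_le.2 ⟨?_, ?_⟩⟩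
    · rw [le_sub_iff_add_le, le_div_iff₀ hδ']
      nlinarith [mul_le_mul_of_nonneg_left hδδ' hθ.le]
    · rw [sub_le_iff_le_add, div_le_iff₀ hδ']
      nlinarith [mul_nonneg hθ.le hδ'.le]
  obtain ⟨κ', hκ'0, hκ'δ, hκ'1⟩ : ∃ κ' : ℝ, 0 < κ' ∧ κ' * δ = δ' ∧ |κ' - 1| ≤ θ := by
    refine ⟨δ' / δ, div_pos hδ' hδ, div_mul_cancel₀ δ' hδ.ne', abs_le.2 ⟨?_, ?_⟩⟩
    · rw [le_sub_iff_add_le, le_div_iff₀ hδ]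
      nlinarith [mul_nonneg hθ.le hδ.le]
    · rw [sub_le_iff_le_add, div_le_iff₀ hδ]
      nlinarith [hratio]
  have hκC : (κ : ℂ) ≠ 0 := Complex.ofReal_ne_zero.2 hκ0.ne'
  have hκ'C : (κ' : ℂ) ≠ 0 := Complex.ofReal_ne_zero.2 hκ'0.ne'
  -- (5) dilation covariance: `T` crossed at mesh `δ'` iff `κ • QT` raw-crossed at mesh `δ`, etc.
  have hXT1 : {ω : BondConfig (Site 2) | ∃ K, QT.IsCrossing K ∧ K ⊆ openEdgeUnion δ' ω} =
      {ω | ∃ K, (QT.mapHomeomorph (Homeomorph.mulLeft₀ (κ : ℂ) hκC)).IsCrossing K ∧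
        K ⊆ openEdgeUnion δ ω} := by
    rw [← hκδ]
    exact (setOf_raw_mapHomeomorph_mulLeft₀ hκ0.ne' QT δ').symm
  have hXT2 : {ω : BondConfig (Site 2) | ∃ K, QT.IsCrossing K ∧ K ⊆ openEdgeUnion δ ω} =
      {ω | ∃ K, (QT.mapHomeomorph (Homeomorph.mulLeft₀ (κ' : ℂ) hκ'C)).IsCrossing K ∧
        K ⊆ openEdgeUnion δ' ω} := by
    rw [← hκ'δ]
    exact (setOf_raw_mapHomeomorph_mulLeft₀ hκ'0.ne' QT δ).symm
  -- (6) assembly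
  refine ⟨?_, ?_⟩
  · rw [hWraw hδ, hTraw hδ', hXT1]
    exact measureReal_sub_lt_of_le_ofReal_half _ hε
      (Hpair Q (mem_singleton Q) QW _ hdW (hdil hκC hκ1) δ hδ hδ₁')
  · rw [hWraw hδ', hTraw hδ, hXT2]
    exact measureReal_sub_lt_of_le_ofReal_half _ hε
      (Hpair Q (mem_singleton Q) QW _ hdW (hdil hκ'C hκ'1) δ' hδ' hδ'₁)

end Summit.CriticalPhenomena.CardyFormulaZ2.Theorems.ClusterSetConnected

end
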